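import Mathlib.LinearAlgebra.FiniteDimensional.Lemmas
import Mathlib.Data.ZMod.Basic
import Mathlib.Algebra.Field.ZMod
import Mathlib.Algebra.BigOperators.Fin
import HarnessLib

/-!
# PlaneDivAscent — plane-divisible point sets over `𝔽_p`: periods, slices, descent (PART A)
(cell decomp-qadv, lens 6 «barrier-complement carving», g21; tree-ready, Prop-definition-free; Part B =
`Theorems.CharDialPlaneDivAscentB`: codimension counting, the all-but-one lemma and the finite-band engine)

Setting.  `V = Fin n → ZMod p`, `W ≤ V` a subspace, `S : Finset V`.  `S` is PLANE-DIVISIBLE IN `W` when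
`S ⊆ W` and every parametrised affine plane of `W` meets `S` in `≡ 0 (mod p)` points
(`∀ x a b ∈ W, p ∣ planeCount S x a b`; by Delsarte / Assmus–Key duality this is `deg 1_S ≤ 2p - 3` on `W`,
the class behind the second structure law of the CharDial degree ladder — lens-6 g20 node «FormReach»,
piece B, «B ⟺ K_field(p) < ∞»).  `perIn W S` is the SUBSPACE of translation periods of `S` inside `W`;
"`S` is a cylinder over `≤ K` coordinates of `W`" reads `finrank W ≤ finrank (perIn W S) + K`.

This part: the period space (`perIn`, closed under `𝔽_p`-scalars via `nsmul`), hyperplane decompositions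
`W = W₀ ⊕ ⟨d⟩` inside the ambient space (`exists_hyperplane`), slices `{y ∈ W₀ : y + t•d₀ ∈ S}` and sections
`S ∩ W₀` stay plane-divisible (`slice_subset`/`dvd_planeCount_slice`, `restrictTo_subset`/`dvd_planeCount_restrictTo`),
period transfer (`period_of_slices`, `period_of_restrictTo`), and DESCENT (`finrank_le_of_period`: a nonzero
period plus the codimension law one dimension down gives the law).
-/

set_option autoImplicit false

namespace Summit.QuantumAdvantage.AdviceFreeQNC0.PlaneDiv

open Finset Module

variable {p : ℕ} [Fact p.Prime] {n : ℕ}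

/-! ## (1) the parametrised plane count and periods -/

/-- Number of parameter pairs `(s,t) ∈ 𝔽_p × 𝔽_p` with `x + s•a + t•b ∈ S` (for independent `a, b` this is
`|S ∩ (x + ⟨a,b⟩)|`; for dependent `a, b` it is automatically a multiple of `p`). -/
def planeCount (S : Finset (Fin n → ZMod p)) (x a b : Fin n → ZMod p) : ℕ :=
  (Finset.univ.filter fun st : ZMod p × ZMod p => x + st.1 • a + st.2 • b ∈ S).card

/-- `0` is a period. -/
theorem period_zero (S : Finset (Fin n → ZMod p)) : ∀ x, x ∈ S ↔ x + (0 : Fin n → ZMod p) ∈ S :=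
  fun x => by simp

/-- Periods add. -/
theorem period_add {S : Finset (Fin n → ZMod p)} {d e : Fin n → ZMod p}
    (hd : ∀ x, x ∈ S ↔ x + d ∈ S) (he : ∀ x, x ∈ S ↔ x + e ∈ S) : ∀ x, x ∈ S ↔ x + (d + e) ∈ S :=
  fun x => by rw [hd x, he (x + d), add_assoc]

/-- Natural multiples of a period are periods. -/
theorem period_nsmul {S : Finset (Fin n → ZMod p)} {d : Fin n → ZMod p}
    (hd : ∀ x, x ∈ S ↔ x + d ∈ S) : ∀ k : ℕ, ∀ x, x ∈ S ↔ x + k • d ∈ S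
  | 0 => by simp
  | k + 1 => by rw [succ_nsmul]; exact period_add (period_nsmul hd k) hd

/-- Scalar multiples of a period are periods (`𝔽_p`-scalars are natural multiples). -/
theorem period_smul {S : Finset (Fin n → ZMod p)} {d : Fin n → ZMod p}
    (hd : ∀ x, x ∈ S ↔ x + d ∈ S) (c : ZMod p) : ∀ x, x ∈ S ↔ x + c • d ∈ S := by
  have : c • d = c.val • d := by
    rw [← Nat.cast_smul_eq_nsmul (ZMod p) c.val d, ZMod.natCast_zmod_val]
  rw [this]
  exact period_nsmul hd c.val

/-- The period space of `S` inside `W`: vectors of `W` translating `S` onto itself. -/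
def perIn (W : Submodule (ZMod p) (Fin n → ZMod p)) (S : Finset (Fin n → ZMod p)) :
    Submodule (ZMod p) (Fin n → ZMod p) where
  carrier := {d | d ∈ W ∧ ∀ x, x ∈ S ↔ x + d ∈ S}
  zero_mem' := ⟨W.zero_mem, period_zero S⟩
  add_mem' := fun ha hb => ⟨W.add_mem ha.1 hb.1, period_add ha.2 hb.2⟩
  smul_mem' := fun c _ hd => ⟨W.smul_mem c hd.1, period_smul hd.2 c⟩

/-- Membership in the period space. -/
theorem mem_perIn {W : Submodule (ZMod p) (Fin n → ZMod p)} {S : Finset (Fin n → ZMod p)}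
    {d : Fin n → ZMod p} : d ∈ perIn W S ↔ d ∈ W ∧ ∀ x, x ∈ S ↔ x + d ∈ S := Iff.rfl

/-- The period space lies in `W`. -/
theorem perIn_le (W : Submodule (ZMod p) (Fin n → ZMod p)) (S : Finset (Fin n → ZMod p)) :
    perIn W S ≤ W := fun _ h => h.1

/-- A period space of codimension `< dim W` contains a nonzero vector. -/
theorem exists_period_of_finrank_le {W : Submodule (ZMod p) (Fin n → ZMod p)}
    {S : Finset (Fin n → ZMod p)} {K : ℕ}
    (h : finrank (ZMod p) W ≤ finrank (ZMod p) (perIn W S) + K) (hK : K < finrank (ZMod p) W) :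
    ∃ d ∈ perIn W S, d ≠ 0 := by
  have h1 : 1 ≤ finrank (ZMod p) (perIn W S) := by omega
  exact Submodule.exists_mem_ne_zero_of_ne_bot (Submodule.one_le_finrank_iff.mp h1)

/-! ## (2) hyperplane decompositions `W = W₀ ⊕ ⟨d⟩` inside the ambient space -/

/-- For `0 ≠ d ∈ W` there is `W₀ ≤ W` with `W₀ ⊓ ⟨d⟩ = ⊥`, `W = W₀ + ⟨d⟩` and `dim W₀ + 1 = dim W`. -/
theorem exists_hyperplane {W : Submodule (ZMod p) (Fin n → ZMod p)} {d : Fin n → ZMod p}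
    (hd : d ∈ W) (hd0 : d ≠ 0) :
    ∃ W₀ : Submodule (ZMod p) (Fin n → ZMod p), W₀ ≤ W ∧ W₀ ⊓ (ZMod p ∙ d) = ⊥ ∧
      (∀ x ∈ W, ∃ y ∈ W₀, ∃ t : ZMod p, x = y + t • d) ∧
      finrank (ZMod p) W₀ + 1 = finrank (ZMod p) W := by
  obtain ⟨C, hC⟩ := Submodule.exists_isCompl (ZMod p ∙ d)
  have hbot : (W ⊓ C) ⊓ (ZMod p ∙ d) = ⊥ := by
    rw [eq_bot_iff]
    calc (W ⊓ C) ⊓ (ZMod p ∙ d) ≤ (ZMod p ∙ d) ⊓ C :=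
          le_inf inf_le_right (le_trans inf_le_left inf_le_right)
      _ = ⊥ := hC.inf_eq_bot
      _ ≤ ⊥ := le_rfl
  have hdec : ∀ x ∈ W, ∃ y ∈ W ⊓ C, ∃ t : ZMod p, x = y + t • d := by
    intro x hx
    have hx' : x ∈ (ZMod p ∙ d) ⊔ C := by rw [hC.sup_eq_top]; exact Submodule.mem_top
    obtain ⟨v, hv, c, hc, hvc⟩ := Submodule.mem_sup.mp hx'
    obtain ⟨t, rfl⟩ := Submodule.mem_span_singleton.mp hv
    refine ⟨c, ⟨?_, hc⟩, t, ?_⟩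
    · have : c = x - t • d := by rw [← hvc]; abel
      rw [this]
      exact W.sub_mem hx (W.smul_mem t hd)
    · rw [← hvc, add_comm]
  refine ⟨W ⊓ C, inf_le_left, hbot, hdec, ?_⟩
  have key := Submodule.finrank_sup_add_finrank_inf_eq (W ⊓ C) (ZMod p ∙ d)
  have hsup : (W ⊓ C) ⊔ (ZMod p ∙ d) = W := by
    apply le_antisymm
    · exact sup_le inf_le_left ((Submodule.span_singleton_le_iff_mem d W).mpr hd)
    · intro x hx
      obtain ⟨y, hy, t, rfl⟩ := hdec x hx
      exact Submodule.add_mem_sup hy (Submodule.mem_span_singleton.mpr ⟨t, rfl⟩)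
  rw [hbot, hsup, finrank_bot, finrank_span_singleton hd0] at key
  omega

/-! ## (3) slices along a direction and sections by a hyperplane -/

open Classical in
/-- The `t`-slice of `S` along `d₀`, read in `W₀`: `{y ∈ W₀ | y + t•d₀ ∈ S}`. -/
noncomputable def slice (W₀ : Submodule (ZMod p) (Fin n → ZMod p)) (S : Finset (Fin n → ZMod p))
    (d₀ : Fin n → ZMod p) (t : ZMod p) : Finset (Fin n → ZMod p) :=
  (S.image fun x => x - t • d₀).filter fun y => y ∈ W₀

/-- Membership in a slice. -/
theorem mem_slice {W₀ : Submodule (ZMod p) (Fin n → ZMod p)} {S : Finset (Fin n → ZMod p)}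
    {d₀ : Fin n → ZMod p} {t : ZMod p} {y : Fin n → ZMod p} :
    y ∈ slice W₀ S d₀ t ↔ y ∈ W₀ ∧ y + t • d₀ ∈ S := by
  unfold slice
  simp only [Finset.mem_filter, Finset.mem_image]
  constructor
  · rintro ⟨⟨x, hx, rfl⟩, hy⟩
    exact ⟨hy, by simpa using hx⟩
  · rintro ⟨hy, hx⟩
    exact ⟨⟨y + t • d₀, hx, by simp⟩, hy⟩

open Classical in
/-- The section `S ∩ W₀` as a finset. -/
noncomputable def restrictTo (W₀ : Submodule (ZMod p) (Fin n → ZMod p))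
    (S : Finset (Fin n → ZMod p)) : Finset (Fin n → ZMod p) :=
  S.filter fun y => y ∈ W₀

/-- Membership in a section. -/
theorem mem_restrictTo {W₀ : Submodule (ZMod p) (Fin n → ZMod p)} {S : Finset (Fin n → ZMod p)}
    {y : Fin n → ZMod p} : y ∈ restrictTo W₀ S ↔ y ∈ S ∧ y ∈ W₀ := by
  unfold restrictTo
  simp only [Finset.mem_filter]

/-- Slices lie in `W₀`. -/
theorem slice_subset (W₀ : Submodule (ZMod p) (Fin n → ZMod p)) (S : Finset (Fin n → ZMod p))
    (d₀ : Fin n → ZMod p) (t : ZMod p) : ∀ y ∈ slice W₀ S d₀ t, y ∈ W₀ :=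
  fun _ hy => (mem_slice.mp hy).1

/-- Sections lie in `W₀`. -/
theorem restrictTo_subset (W₀ : Submodule (ZMod p) (Fin n → ZMod p)) (S : Finset (Fin n → ZMod p)) :
    ∀ y ∈ restrictTo W₀ S, y ∈ W₀ :=
  fun _ hy => (mem_restrictTo.mp hy).2

/-- Plane counts of a slice are plane counts of `S` (the plane of `W₀` shifted by `t•d₀`). -/
theorem planeCount_slice {W₀ : Submodule (ZMod p) (Fin n → ZMod p)} (S : Finset (Fin n → ZMod p))
    (d₀ : Fin n → ZMod p) (t : ZMod p) {x a b : Fin n → ZMod p} (hx : x ∈ W₀) (ha : a ∈ W₀)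
    (hb : b ∈ W₀) : planeCount (slice W₀ S d₀ t) x a b = planeCount S (x + t • d₀) a b := by
  unfold planeCount
  congr 1
  apply Finset.filter_congr
  intro st _
  rw [mem_slice]
  have hmem : x + st.1 • a + st.2 • b ∈ W₀ :=
    W₀.add_mem (W₀.add_mem hx (W₀.smul_mem _ ha)) (W₀.smul_mem _ hb)
  have heq : x + st.1 • a + st.2 • b + t • d₀ = x + t • d₀ + st.1 • a + st.2 • b := by abel
  simp only [hmem, true_and, heq]

/-- Slices of a plane-divisible set are plane-divisible in `W₀`. -/
theorem dvd_planeCount_slice {W W₀ : Submodule (ZMod p) (Fin n → ZMod p)}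
    {S : Finset (Fin n → ZMod p)} {d₀ : Fin n → ZMod p}
    (hdiv : ∀ x ∈ W, ∀ a ∈ W, ∀ b ∈ W, p ∣ planeCount S x a b) (hW₀ : W₀ ≤ W) (hd₀ : d₀ ∈ W)
    (t : ZMod p) : ∀ x ∈ W₀, ∀ a ∈ W₀, ∀ b ∈ W₀, p ∣ planeCount (slice W₀ S d₀ t) x a b := by
  intro x hx a ha b hb
  rw [planeCount_slice S d₀ t hx ha hb]
  exact hdiv _ (W.add_mem (hW₀ hx) (W.smul_mem t hd₀)) a (hW₀ ha) b (hW₀ hb)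

/-- Plane counts of a section inside `W₀` are plane counts of `S`. -/
theorem planeCount_restrictTo {W₀ : Submodule (ZMod p) (Fin n → ZMod p)} (S : Finset (Fin n → ZMod p))
    {x a b : Fin n → ZMod p} (hx : x ∈ W₀) (ha : a ∈ W₀) (hb : b ∈ W₀) :
    planeCount (restrictTo W₀ S) x a b = planeCount S x a b := by
  unfold planeCount
  congr 1
  apply Finset.filter_congr
  intro st _
  rw [mem_restrictTo]
  have hmem : x + st.1 • a + st.2 • b ∈ W₀ :=
    W₀.add_mem (W₀.add_mem hx (W₀.smul_mem _ ha)) (W₀.smul_mem _ hb)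
  simp only [hmem, and_true]

/-- Sections of a plane-divisible set are plane-divisible in `W₀`. -/
theorem dvd_planeCount_restrictTo {W W₀ : Submodule (ZMod p) (Fin n → ZMod p)}
    {S : Finset (Fin n → ZMod p)}
    (hdiv : ∀ x ∈ W, ∀ a ∈ W, ∀ b ∈ W, p ∣ planeCount S x a b) (hW₀ : W₀ ≤ W) :
    ∀ x ∈ W₀, ∀ a ∈ W₀, ∀ b ∈ W₀, p ∣ planeCount (restrictTo W₀ S) x a b := by
  intro x hx a ha b hb
  rw [planeCount_restrictTo S hx ha hb]
  exact hdiv x (hW₀ hx) a (hW₀ ha) b (hW₀ hb)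

/-! ## (4) period transfer -/

/-- A common period (in `W₀`) of all slices along `d₀` is a period of `S`, when `W = W₀ + ⟨d₀⟩ ⊇ S`. -/
theorem period_of_slices {W W₀ : Submodule (ZMod p) (Fin n → ZMod p)} {S : Finset (Fin n → ZMod p)}
    {d₀ d : Fin n → ZMod p} (hSW : ∀ x ∈ S, x ∈ W) (hW₀ : W₀ ≤ W)
    (hdec : ∀ x ∈ W, ∃ y ∈ W₀, ∃ t : ZMod p, x = y + t • d₀) (hd : d ∈ W₀)
    (hper : ∀ (t : ZMod p) (y : Fin n → ZMod p), y ∈ slice W₀ S d₀ t ↔ y + d ∈ slice W₀ S d₀ t) :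
    ∀ x, x ∈ S ↔ x + d ∈ S := by
  intro x
  by_cases hx : x ∈ W
  · obtain ⟨y, hy, t, rfl⟩ := hdec x hx
    have h1 : y + t • d₀ ∈ S ↔ y ∈ slice W₀ S d₀ t := by rw [mem_slice]; simp [hy]
    have h2 : y + t • d₀ + d ∈ S ↔ y + d ∈ slice W₀ S d₀ t := by
      rw [mem_slice]
      have : y + t • d₀ + d = y + d + t • d₀ := by abel
      simp [W₀.add_mem hy hd, this]
    rw [h1, h2]
    exact hper t y
  · have h1 : x ∉ S := fun h => hx (hSW x h)
    have h2 : x + d ∉ S := by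
      intro h
      have := W.sub_mem (hSW _ h) (hW₀ hd)
      simp at this
      exact hx this
    simp [h1, h2]

/-- A period (in `W₀`) of the section `S ∩ W₀` is a period of `S`, when `W = W₀ + ⟨d⟩ ⊇ S` for a period
`d` of `S`. -/
theorem period_of_restrictTo {W W₀ : Submodule (ZMod p) (Fin n → ZMod p)}
    {S : Finset (Fin n → ZMod p)} {d e : Fin n → ZMod p} (hSW : ∀ x ∈ S, x ∈ W) (hW₀ : W₀ ≤ W)
    (hdec : ∀ x ∈ W, ∃ y ∈ W₀, ∃ t : ZMod p, x = y + t • d) (hd : ∀ x, x ∈ S ↔ x + d ∈ S)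
    (he : e ∈ W₀) (hper : ∀ y, y ∈ restrictTo W₀ S ↔ y + e ∈ restrictTo W₀ S) :
    ∀ x, x ∈ S ↔ x + e ∈ S := by
  intro x
  by_cases hx : x ∈ W
  · obtain ⟨y, hy, t, rfl⟩ := hdec x hx
    have h1 : y + t • d ∈ S ↔ y ∈ S := (period_smul hd t y).symm
    have h2 : y + t • d + e ∈ S ↔ y + e ∈ S := by
      have : y + t • d + e = (y + e) + t • d := by abel
      rw [this]
      exact (period_smul hd t (y + e)).symm
    have h3 : y ∈ S ↔ y ∈ restrictTo W₀ S := by rw [mem_restrictTo]; simp [hy]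
    have h4 : y + e ∈ S ↔ y + e ∈ restrictTo W₀ S := by
      rw [mem_restrictTo]; simp [W₀.add_mem hy he]
    rw [h1, h2, h3, h4]
    exact hper y
  · have h1 : x ∉ S := fun h => hx (hSW x h)
    have h2 : x + e ∉ S := by
      intro h
      have := W.sub_mem (hSW _ h) (hW₀ he)
      simp at this
      exact hx this
    simp [h1, h2]

/-! ## (5) descent: a nonzero period lowers the problem by one dimension -/

/-- DESCENT.  If `S ⊆ W` is plane-divisible with a nonzero period in `W`, and the codimension bound `K`
holds for plane-divisible sets in all subspaces of smaller dimension, then it holds for `S` in `W`. -/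
theorem finrank_le_of_period {W : Submodule (ZMod p) (Fin n → ZMod p)} {S : Finset (Fin n → ZMod p)}
    {K : ℕ} (hSW : ∀ x ∈ S, x ∈ W) (hdiv : ∀ x ∈ W, ∀ a ∈ W, ∀ b ∈ W, p ∣ planeCount S x a b)
    {d : Fin n → ZMod p} (hd : d ∈ perIn W S) (hd0 : d ≠ 0)
    (ih : ∀ (W' : Submodule (ZMod p) (Fin n → ZMod p)) (S' : Finset (Fin n → ZMod p)),
      finrank (ZMod p) W' < finrank (ZMod p) W → (∀ x ∈ S', x ∈ W') →
      (∀ x ∈ W', ∀ a ∈ W', ∀ b ∈ W', p ∣ planeCount S' x a b) →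
      finrank (ZMod p) W' ≤ finrank (ZMod p) (perIn W' S') + K) :
    finrank (ZMod p) W ≤ finrank (ZMod p) (perIn W S) + K := by
  obtain ⟨W₀, hW₀W, hbot, hdec, hrank⟩ := exists_hyperplane hd.1 hd0
  have hK : finrank (ZMod p) W₀ ≤ finrank (ZMod p) (perIn W₀ (restrictTo W₀ S)) + K :=
    ih W₀ _ (by omega) (restrictTo_subset W₀ S) (dvd_planeCount_restrictTo hdiv hW₀W)
  have hle : perIn W₀ (restrictTo W₀ S) ⊔ (ZMod p ∙ d) ≤ perIn W S := by
    refine sup_le ?_ ((Submodule.span_singleton_le_iff_mem d _).mpr hd)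
    intro e he
    exact ⟨hW₀W he.1, period_of_restrictTo hSW hW₀W hdec hd.2 he.1 he.2⟩
  have hinf : perIn W₀ (restrictTo W₀ S) ⊓ (ZMod p ∙ d) = ⊥ := by
    rw [eq_bot_iff, ← hbot]
    exact inf_le_inf_right _ (perIn_le _ _)
  have key := Submodule.finrank_sup_add_finrank_inf_eq (perIn W₀ (restrictTo W₀ S)) (ZMod p ∙ d)
  rw [hinf, finrank_bot, finrank_span_singleton hd0] at key
  have hmono := Submodule.finrank_mono hle
  omega

end Summit.QuantumAdvantage.AdviceFreeQNC0.PlaneDiv
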